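import Summits.KontsevichZagierPeriods.KontsevichZagierPeriods.Theorems.FermatIsogenyBetaLinearSectorSixthsStubLink43Tail
import HarnessLib

/-!
# `BetaLinearSector` (stmt-KontsevichZagierPeriods-3897), line `fermat-sector-transport` —
# stub `stub_link45_tail_of_iso` (link L3 of the level-6 rung: `B(2/3,5/6) = (4/√3)·∫₁^∞ dX/(X²√(X³−1))`)

GIVEN the second-kind `3`-isogeny pull-backs `[arc, 9√3x⁴/((x³+4)²√(x³+1))] ∼ [(1,∞), 1/(X²√(X³−1))]` on the
arcs `(0,2)` and `(2,∞)` of `E₊ : y² = x³ + 1` (hypotheses; the neighbouring stubs), every Beta cell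
`U = [(0,1), t^{-1/3}(1-t)^{-1/6}]` (value `B(2/3,5/6) = 1.72473…`) is KZ-equivalent to every tail
`A = [(1,∞), 4/(√3·X²√(X³−1))]`, inside the Kontsevich–Zagier calculus of moves (`KZCalculus.lean`):

1. ONE exact form on `(0,1)`: `K(t) = 6t^{2/3}(1-t)^{5/6}/(4-3t)` is `ℚ`-semialgebraic, continuous on `[0,1]`,
   `K(0) = K(1) = 0`, so `[(0,1), K′] ∈ relations` (one Newton–Leibniz move from the point, null endpoints:
   `of_mem_relations_of_hasDerivAt`), and ONE integrand-additivity move: `U ∼ G = [(0,1), t^{-1/3}(1-t)^{-1/6} − K′]`;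
2. ONE change of variables `t = x³/(x³+1)` from `(0,∞)` onto `(0,1)` (rule (2)) with the EXACT Jacobian identity
   `(t^{-1/3}(1-t)^{-1/6} − K′(t))·t′(x) = 18x⁴/((x³+4)²√(x³+1))` (`link45_jacobian`: all sixth roots are powers of
   `c = (x³+1)^{1/6}` and only `c⁻³ = 1/√(x³+1)` survives): `G ∼ W = [(0,∞), 18x⁴/((x³+4)²√(x³+1))]`;
3. rule (1a) at `x = 2`, the hypotheses applied to `(√3/2)·W|_(0,2)`, `(√3/2)·W|_(2,∞)` and scaled back by `2/√3`
   (`KZ.Equivalent.constMul`), rule (1b) `[(4/√3)f] = [(2/√3)f] + [(2/√3)f]`, and `(4/3)√3/(X²√) = 4/(√3X²√)`.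

References: M. Kontsevich, D. Zagier, *Periods* (2001), §1.2 rules (1)–(3); G. E. Andrews, R. Askey, R. Roy,
*Special Functions* (1999), §1.1.
-/

noncomputable section

namespace Summit.KontsevichZagierPeriods.FermatIsogeny.BetaLinearSector.Sixths

open Set MeasureTheory
open MvPolynomial (aeval X C)
open Literature.NumberTheory.Transcendental Literature.NumberTheory.Transcendental.KZ
open Literature.ModelTheory.ExponentialFields (IsSemialgebraic)
open Summit.KontsevichZagierPeriods.HermiteRigidity.CMTwistQuasiPeriodTransfer
  (of_sub_of_mem_changeOfVariablesRel_dimOne image_fin_one of_sub_of_sub_mem_relations_split of_mem_relations_of_hasDerivAt)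
open Summit.KontsevichZagierPeriods.KontsevichZagierPeriods.Theorems.GKZLevelThree (isSemialgebraicFunOn_ratFun₁)

/-! ## Real algebra of the substitution `t = x³/(x³+1)` -/

/-- **The sixth-root atoms.** For `x > 0` and `c := (x³+1)^{1/6}` (`c⁶ = x³+1`, `√(x³+1) = c³`, `t = (x/c²)³`,
`1 − t = (1/c)⁶`): the six real powers of `t`, `1 − t` entering `t^{-1/3}(1-t)^{-1/6}` and `K′`, written so that
every product of them is `c⁻³` times a rational function of `x`. [folklore] -/
theorem link45_atoms {x : ℝ} (hx : 0 < x) :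
    ∃ c : ℝ, 0 < c ∧ Real.sqrt (x ^ 3 + 1) = c ^ 3 ∧
      (x ^ 3 / (x ^ 3 + 1)) ^ ((2:ℝ) / 3) = x ^ 2 / c ^ 4 ∧
      (x ^ 3 / (x ^ 3 + 1)) ^ ((2:ℝ) / 3 - 1) = (x ^ 3 + 1) / (x * c ^ 4) ∧
      (x ^ 3 / (x ^ 3 + 1)) ^ (-(1:ℝ) / 3) = (x ^ 3 + 1) / (x * c ^ 4) ∧
      (1 - x ^ 3 / (x ^ 3 + 1)) ^ ((5:ℝ) / 6) = c / (x ^ 3 + 1) ∧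
      (1 - x ^ 3 / (x ^ 3 + 1)) ^ ((5:ℝ) / 6 - 1) = c ∧ (1 - x ^ 3 / (x ^ 3 + 1)) ^ (-(1:ℝ) / 6) = c := by
  have hx3 : 0 < x ^ 3 + 1 := by positivity
  set c : ℝ := (x ^ 3 + 1) ^ ((6:ℕ)⁻¹ : ℝ) with hc_def
  have hc : 0 < c := Real.rpow_pos_of_pos hx3 _
  have hc6 : c ^ 6 = x ^ 3 + 1 := Real.rpow_inv_natCast_pow hx3.le (by norm_num)
  set y : ℝ := x / c ^ 2 with hy_def
  have hy : 0 < y := by positivity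
  have ht : x ^ 3 / (x ^ 3 + 1) = y ^ 3 := by rw [← hc6, hy_def, div_pow]; ring
  have h1t : 1 - x ^ 3 / (x ^ 3 + 1) = (c⁻¹) ^ 6 := by
    rw [← hc6, inv_pow]
    field_simp
    linarith [hc6]
  have hci : 0 ≤ c⁻¹ := inv_nonneg.2 hc.le
  have hT : ∀ r : ℝ, (x ^ 3 / (x ^ 3 + 1)) ^ r = y ^ ((3:ℕ) * r) := fun r => by
    rw [ht, ← Real.rpow_natCast y 3, ← Real.rpow_mul hy.le]
  have hS : ∀ r : ℝ, (1 - x ^ 3 / (x ^ 3 + 1)) ^ r = c⁻¹ ^ ((6:ℕ) * r) := fun r => by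
    rw [h1t, ← Real.rpow_natCast c⁻¹ 6, ← Real.rpow_mul hci]
  refine ⟨c, hc, ?_, ?_, ?_, ?_, ?_, ?_, ?_⟩
  · rw [show x ^ 3 + 1 = (c ^ 3) ^ 2 by rw [← hc6]; ring]
    exact Real.sqrt_sq (pow_pos hc 3).le
  · rw [hT]; norm_num; rw [hy_def, div_pow]; ring
  · rw [hT]; norm_num; rw [Real.rpow_neg_one, hy_def, ← hc6]; field_simp
  · rw [hT]; norm_num; rw [Real.rpow_neg_one, hy_def, ← hc6]; field_simp
  · rw [hS]; norm_num; rw [← hc6]; field_simp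
  · rw [hS]; norm_num; rw [Real.rpow_neg_one, inv_inv]
  · rw [hS]; norm_num; rw [Real.rpow_neg_one, inv_inv]

/-- **The exact Jacobian identity of link L3.** For `y > 0` and `t = y³/(y³+1)`,
`(t^{-1/3}(1-t)^{-1/6} − K′(t))·|t′(y)| = 18y⁴/((y³+4)²√(y³+1))`, `K(t) = 6t^{2/3}(1-t)^{5/6}/(4-3t)`,
`t′(y) = 3y²/(y³+1)²` (`K′` in the shape the derivative rules produce). [cite: KontsevichZagier2001, §1.2 rule (2)] -/
theorem link45_jacobian {y t : ℝ} (hy : 0 < y) (ht : t = y ^ 3 / (y ^ 3 + 1)) :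
    (t ^ (-(1:ℝ) / 3) * (1 - t) ^ (-(1:ℝ) / 6) -
      6 * ((((2:ℝ) / 3 * t ^ ((2:ℝ) / 3 - 1) * (1 - t) ^ ((5:ℝ) / 6) +
        t ^ ((2:ℝ) / 3) * (-1 * ((5:ℝ) / 6) * (1 - t) ^ ((5:ℝ) / 6 - 1))) * (4 - 3 * t) -
        t ^ ((2:ℝ) / 3) * (1 - t) ^ ((5:ℝ) / 6) * (-3)) / (4 - 3 * t) ^ 2)) *
      |3 * y ^ 2 / (y ^ 3 + 1) ^ 2| = 18 * y ^ 4 / ((y ^ 3 + 4) ^ 2 * Real.sqrt (y ^ 3 + 1)) := by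
  subst ht
  obtain ⟨c, hc, hs, a1, a2, a2', a3, a4, a4'⟩ := link45_atoms hy
  rw [hs, a1, a2, a2', a3, a4, a4']
  have hy3 : y ^ 3 + 1 ≠ 0 := by positivity
  have hy4 : y ^ 3 + 4 ≠ 0 := by positivity
  have h43 : (4:ℝ) - 3 * (y ^ 3 / (y ^ 3 + 1)) = (y ^ 3 + 4) / (y ^ 3 + 1) := by field_simp; ring
  rw [h43, abs_of_pos (show 0 < 3 * y ^ 2 / (y ^ 3 + 1) ^ 2 by positivity)]
  field_simp
  ring

/-- `t(y) = y³/(y³+1)` has derivative `3y²/(y³+1)²` (`y > 0`), is injective on `(0,∞)` (`a³ = b³`) and maps `(0,∞)`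
onto `(0,1)` (preimage `(t/(1-t))^{1/3}`). [folklore] -/
theorem link45_phi :
    (∀ {y : ℝ}, 0 < y → HasDerivAt (fun s : ℝ => s ^ 3 / (s ^ 3 + 1)) (3 * y ^ 2 / (y ^ 3 + 1) ^ 2) y) ∧
    (∀ {a b : ℝ}, 0 < a → 0 < b → a ^ 3 / (a ^ 3 + 1) = b ^ 3 / (b ^ 3 + 1) → a = b) ∧
    (∀ {y : ℝ}, 0 < y → y ^ 3 / (y ^ 3 + 1) ∈ Set.Ioo (0:ℝ) 1) ∧
    (fun s : ℝ => s ^ 3 / (s ^ 3 + 1)) '' Set.Ioi 0 = Set.Ioo 0 1 := by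
  have hmem : ∀ {y : ℝ}, 0 < y → y ^ 3 / (y ^ 3 + 1) ∈ Set.Ioo (0:ℝ) 1 := fun hy =>
    ⟨by positivity, by rw [div_lt_one (by positivity)]; linarith⟩
  refine ⟨fun {y} hy => ?_, fun {a b} ha hb h => ?_, hmem, ?_⟩
  · have hnum : HasDerivAt (fun s : ℝ => s ^ 3) (3 * y ^ 2) y := by simpa using hasDerivAt_pow 3 y
    have hden : HasDerivAt (fun s : ℝ => s ^ 3 + 1) (3 * y ^ 2) y := by simpa using hnum.add_const (1:ℝ)
    have h0 : y ^ 3 + 1 ≠ 0 := by positivity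
    refine (hnum.fun_div hden h0).congr_deriv ?_
    field_simp
    ring
  · rw [div_eq_div_iff (by positivity) (by positivity)] at h
    exact (Odd.pow_injective (by decide : Odd 3)) (by linarith : a ^ 3 = b ^ 3)
  · ext t
    refine ⟨fun ⟨y, hy, hyt⟩ => hyt ▸ hmem hy, fun ht => ?_⟩
    have hq : 0 < t / (1 - t) := div_pos ht.1 (by linarith [ht.2])
    set y : ℝ := (t / (1 - t)) ^ ((3:ℕ)⁻¹ : ℝ) with hy_def
    have hy3 : y ^ 3 = t / (1 - t) := Real.rpow_inv_natCast_pow hq.le (by norm_num)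
    refine ⟨y, Real.rpow_pos_of_pos hq _, ?_⟩
    show y ^ 3 / (y ^ 3 + 1) = t
    have h1t : (1:ℝ) - t ≠ 0 := by linarith [ht.2]
    rw [hy3]
    field_simp
    ring

/-- `q·√3` is algebraic over `ℚ` for every rational `q` (`√3` is a root of `X² − 3`): the scaling constants
`√3/2 = (1/2)√3`, `2/√3 = (2/3)√3`, `4/√3 = (4/3)√3`. [cite: KontsevichZagier2001, §1.1] -/
theorem link45_isAlgebraic_rat_mul_sqrt3 (q : ℚ) : IsAlgebraic ℚ ((q : ℝ) * Real.sqrt 3) := by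
  have hs3 : Real.sqrt 3 ^ 2 = 3 := Real.sq_sqrt (by norm_num)
  have h3 : IsAlgebraic ℚ (Real.sqrt 3) := by
    refine ⟨Polynomial.X ^ 2 - Polynomial.C 3, Polynomial.X_pow_sub_C_ne_zero (by norm_num) 3, ?_⟩
    simp [hs3]
  simpa [Rat.smul_def] using h3.smul q

/-! ## Step 1: the exact form `[(0,1), K′]` -/

/-- **The exact form.** `D = [(0,1), K′]` exists and is a relation, `K(t) = 6t^{2/3}(1-t)^{5/6}/(4-3t)`: `K` is
`ℚ`-semialgebraic on `(0,1)` (Euler–Mellin monomial times the pole-free `1/(4-3t)`), continuous on `[0,1]`,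
`K(0) = K(1) = 0`, differentiable inside with derivative `K′` (kept in the shape the rules produce), itself
`ℚ`-semialgebraic and integrable on `(0,1)` (Beta integrands, `4 − 3t ≥ 1`); ONE Newton–Leibniz move from the
point over `[0,1]` and the null endpoints (`of_mem_relations_of_hasDerivAt`). [cite: KontsevichZagier2001, §1.2 rule (3)] -/
theorem link45_exists_D : ∃ D : IntegralRep 1, D.domain = {x : Fin 1 → ℝ | x 0 ∈ Set.Ioo (0:ℝ) 1} ∧
    (D.integrand = fun x => 6 * ((((2:ℝ) / 3 * x 0 ^ ((2:ℝ) / 3 - 1) * (1 - x 0) ^ ((5:ℝ) / 6) +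
        x 0 ^ ((2:ℝ) / 3) * (-1 * ((5:ℝ) / 6) * (1 - x 0) ^ ((5:ℝ) / 6 - 1))) * (4 - 3 * x 0) -
        x 0 ^ ((2:ℝ) / 3) * (1 - x 0) ^ ((5:ℝ) / 6) * (-3)) / (4 - 3 * x 0) ^ 2)) ∧
    KZ.of D ∈ KZ.relations := by
  set kd : ℝ → ℝ := fun t => 6 * ((((2:ℝ) / 3 * t ^ ((2:ℝ) / 3 - 1) * (1 - t) ^ ((5:ℝ) / 6) +
    t ^ ((2:ℝ) / 3) * (-1 * ((5:ℝ) / 6) * (1 - t) ^ ((5:ℝ) / 6 - 1))) * (4 - 3 * t) -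
    t ^ ((2:ℝ) / 3) * (1 - t) ^ ((5:ℝ) / 6) * (-3)) / (4 - 3 * t) ^ 2) with hkd
  set K : ℝ → ℝ := fun t => 6 * (t ^ ((2:ℝ) / 3) * (1 - t) ^ ((5:ℝ) / 6) / (4 - 3 * t)) with hK
  set I : Set (Fin 1 → ℝ) := {x | x 0 ∈ Set.Ioo (0:ℝ) 1} with hI_def
  have hI : IsSemialgebraic ℚ I := BallPeeling.isSemialgebraic_posIoo
  have hden : ∀ x ∈ I, (4:ℝ) - 3 * x 0 ≠ 0 := fun x hx => by have h := hx.2; linarith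
  -- semialgebraicity of `K` and `K′`
  have hr : IsSemialgebraicFunOn ℚ I (fun x => (4 - 3 * x 0)⁻¹) :=
    ((isSemialgebraicFunOn_aeval hI (4 - 3 * X 0)).congr fun p _ => by simp).fun_inv
  have hKsa : IsSemialgebraicFunOn ℚ I (fun x => K (x 0)) :=
    ((isSemialgebraicFunOn_const_mul_rpow_mul_rpow 6 (2 / 3) (5 / 6)).fun_mul hr).congr fun x _ => by
      simp only [hK]; push_cast; ring
  have hkdsa : IsSemialgebraicFunOn ℚ I (fun x => kd (x 0)) := by
    refine ((((isSemialgebraicFunOn_const_mul_rpow_mul_rpow 4 (2 / 3 - 1) (5 / 6)).fun_add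
      (isSemialgebraicFunOn_const_mul_rpow_mul_rpow (-5) (2 / 3) (5 / 6 - 1))).fun_mul hr).fun_add
      ((isSemialgebraicFunOn_const_mul_rpow_mul_rpow 18 (2 / 3) (5 / 6)).fun_mul (hr.fun_pow 2))).congr
      fun x hx => ?_
    have h0 := hden x hx
    simp only [hkd]
    push_cast
    field_simp
    ring
  -- integrability of `K′` on `(0,1)`
  have hB : ∀ {a b : ℝ}, 0 < a → 0 < b →
      IntegrableOn (fun t : ℝ => t ^ (a - 1) * (1 - t) ^ (b - 1)) (Set.Ioo 0 1) := fun ha hb =>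
    (Literature.Analysis.SpecialFunctions.Selberg.integrableOn_Ioo_rpow_mul_one_sub_rpow_and_integral_eq ha hb).1
  have hI1 : IntegrableOn (fun t : ℝ => t ^ ((2:ℝ) / 3 - 1) * (1 - t) ^ ((5:ℝ) / 6)) (Set.Ioo 0 1) := by
    simpa only [add_sub_cancel_right] using hB (a := (2:ℝ) / 3) (b := (5:ℝ) / 6 + 1) (by norm_num) (by norm_num)
  have hI2 : IntegrableOn (fun t : ℝ => t ^ ((2:ℝ) / 3) * (1 - t) ^ ((5:ℝ) / 6 - 1)) (Set.Ioo 0 1) := by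
    simpa only [add_sub_cancel_right] using hB (a := (2:ℝ) / 3 + 1) (b := (5:ℝ) / 6) (by norm_num) (by norm_num)
  have hI3 : IntegrableOn (fun t : ℝ => t ^ ((2:ℝ) / 3) * (1 - t) ^ ((5:ℝ) / 6)) (Set.Ioo 0 1) := by
    simpa only [add_sub_cancel_right] using
      hB (a := (2:ℝ) / 3 + 1) (b := (5:ℝ) / 6 + 1) (by norm_num) (by norm_num)
  have hq : ∀ s ∈ Set.Icc (0:ℝ) 1, (4:ℝ) - 3 * s ≠ 0 := fun s hs => by linarith [hs.2]
  have hr1 : ContinuousOn (fun s : ℝ => 6 / (4 - 3 * s)) (Set.Icc 0 1) := continuousOn_const.div (by fun_prop) hq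
  have hr2 : ContinuousOn (fun s : ℝ => 18 / (4 - 3 * s) ^ 2) (Set.Icc 0 1) :=
    continuousOn_const.div (by fun_prop) fun s hs => pow_ne_zero 2 (hq s hs)
  have hkdi : IntegrableOn kd (Set.Ioo 0 1) := by
    refine ((IntegrableOn.mul_continuousOn_of_subset ((hI1.const_mul ((2:ℝ) / 3)).add (hI2.const_mul (-((5:ℝ) / 6))))
      hr1 measurableSet_Ioo isCompact_Icc Set.Ioo_subset_Icc_self).add (IntegrableOn.mul_continuousOn_of_subset
      hI3 hr2 measurableSet_Ioo isCompact_Icc Set.Ioo_subset_Icc_self)).congr_fun (fun t ht => ?_) measurableSet_Ioo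
    have hq0 : (4:ℝ) - 3 * t ≠ 0 := by linarith [ht.2]
    simp only [Pi.add_apply, hkd]
    field_simp
    ring
  -- the representation and the Newton–Leibniz move
  refine ⟨⟨I, fun x => kd (x 0), hI, hkdsa, integrableOn_setOf_apply_mem_iff.2 hkdi⟩, rfl, rfl, ?_⟩
  refine of_mem_relations_of_hasDerivAt zero_lt_one isAlgebraic_zero isAlgebraic_one K _ rfl hKsa ?_
    (fun p hp => ?_) ?_ ?_
  · refine continuousOn_const.mul ((((continuousOn_id.rpow_const fun t _ => Or.inr (by norm_num)).mul
      ((continuousOn_const.sub continuousOn_id).rpow_const fun t _ => Or.inr (by norm_num)))).div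
      (by fun_prop) hq)
  · have ht : p 0 ∈ Set.Ioo (0:ℝ) 1 := hp
    have hqd : HasDerivAt (fun s : ℝ => 4 - 3 * s) (-3) (p 0) := by
      simpa using ((hasDerivAt_id (p 0)).const_mul (3:ℝ)).const_sub (4:ℝ)
    exact ((hasDerivAt_rpow_mul_one_sub_rpow (a := (2:ℝ) / 3) (b := (5:ℝ) / 6) ht).fun_div hqd
      (hden p hp)).const_mul 6
  · simp only [hK]
    rw [Real.zero_rpow (by norm_num)]
    simp
  · simp only [hK]
    rw [sub_self, Real.zero_rpow (by norm_num)]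
    simp

/-! ## The link -/

/-- **Stub `stub_link45_tail_of_iso`** (line `fermat-sector-transport` of `BetaLinearSector`, level `6`, link L3:
`B(2/3,5/6) = (2/3)·B(1/2,2/3)` through the tail).  GIVEN the second-kind `3`-isogeny pull-backs on the arcs
`(0,2)` and `(2,∞)` (`[arc, 9√3x⁴/((x³+4)²√(x³+1))] ∼ [(1,∞), 1/(X²√(X³−1))]` for all so-pinned representations),
every Beta cell `[(0,1), t^{-1/3}(1-t)^{-1/6}]` (value `B(2/3,5/6)`) is KZ-equivalent to every representation
`[(1,∞), 4/(√3·X²√(X³−1))]`: ONE exact form `[(0,1), K′]` (`link45_exists_D`) and ONE integrand-additivity move,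
ONE change of variables `t = x³/(x³+1)` from `(0,∞)` onto `(0,1)` (`link45_jacobian`), rule (1a) at `x = 2`, the
two hypotheses scaled by `2/√3`, rule (1b) and matching of integrands on `(1,∞)`.
[cite: KontsevichZagier2001, §1.2 rules (1)–(3)] [cite: AndrewsAskeyRoy1999, §1.1] -/
theorem stub_link45_tail_of_iso :
    (∀ (S T : KZ.IntegralRep 1), S.domain = {x | 0 < x 0 ∧ x 0 < 2} →
      Set.EqOn S.integrand (fun x => 9 * Real.sqrt 3 * x 0 ^ 4 / ((x 0 ^ 3 + 4) ^ 2 * Real.sqrt (x 0 ^ 3 + 1))) S.domain →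
      T.domain = {x | 1 < x 0} →
      Set.EqOn T.integrand (fun x => 1 / (x 0 ^ 2 * Real.sqrt (x 0 ^ 3 - 1))) T.domain → KZ.Equivalent S T) →
    (∀ (S T : KZ.IntegralRep 1), S.domain = {x | 2 < x 0} →
      Set.EqOn S.integrand (fun x => 9 * Real.sqrt 3 * x 0 ^ 4 / ((x 0 ^ 3 + 4) ^ 2 * Real.sqrt (x 0 ^ 3 + 1))) S.domain →
      T.domain = {x | 1 < x 0} →
      Set.EqOn T.integrand (fun x => 1 / (x 0 ^ 2 * Real.sqrt (x 0 ^ 3 - 1))) T.domain → KZ.Equivalent S T) →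
    ∀ (U A : KZ.IntegralRep 1), U.domain = {x | x 0 ∈ Set.Ioo (0:ℝ) 1} →
      Set.EqOn U.integrand (fun x => (x 0) ^ (-(1:ℝ) / 3) * (1 - x 0) ^ (-(1:ℝ) / 6)) U.domain →
      A.domain = {x | 1 < x 0} →
      Set.EqOn A.integrand (fun x => 4 / (Real.sqrt 3 * (x 0 ^ 2 * Real.sqrt (x 0 ^ 3 - 1)))) A.domain → KZ.Equivalent U A := by
  intro hIso1 hIso2 U A hUd hUi hAd hAi
  obtain ⟨hφd, hφinj, hφmem, hφim⟩ := link45_phi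
  -- Step 1: the exact form `K′` on `(0,1)`: `U ∼ G := [(0,1), u − K′]`
  obtain ⟨D, hDd, hDi, hD⟩ := link45_exists_D
  obtain ⟨G, hGd, hGi⟩ : ∃ G : IntegralRep 1, G.domain = U.domain ∧
      G.integrand = fun x => U.integrand x - D.integrand x :=
    ⟨⟨U.domain, fun x => U.integrand x - D.integrand x, U.isSemialgebraic_domain,
      U.isSemialgebraicFunOn_integrand.fun_sub (by rw [hUd, ← hDd]; exact D.isSemialgebraicFunOn_integrand),
      U.integrableOn.sub (by rw [hUd, ← hDd]; exact D.integrableOn)⟩, rfl, rfl⟩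
  have hadd : KZ.of U - KZ.of G - KZ.of D ∈ KZ.integrandAddRel :=
    ⟨1, U, G, D, hGd, by rw [hDd, hUd], fun x _ => by simp only [Pi.add_apply, hGi, sub_add_cancel], rfl⟩
  have hUG : KZ.of U - KZ.of G ∈ KZ.relations := by
    simpa only [sub_add_cancel] using KZ.relations.add_mem (KZ.integrandAddRel_subset_relations hadd) hD
  -- Step 2: `W = [(0,∞), 18x⁴/((x³+4)²√(x³+1))]` (dominated by `18/√(x³+1)`) and the change of variables
  set pos : Set (Fin 1 → ℝ) := {x | 0 < x 0} with hpos_def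
  have hPos : IsSemialgebraic ℚ pos := KZ.isSemialgebraic_setOf_const_lt_apply isAlgebraic_zero 0
  have hpol : ∀ (q : MvPolynomial (Fin 1) ℚ) (f : (Fin 1 → ℝ) → ℝ), (∀ p, aeval p q = f p) →
      IsSemialgebraicFunOn ℚ pos f := fun q f hf => (isSemialgebraicFunOn_aeval hPos q).congr fun p _ => hf p
  have hWsa : IsSemialgebraicFunOn ℚ pos (fun p => 18 * p 0 ^ 4 / ((p 0 ^ 3 + 4) ^ 2 * Real.sqrt (p 0 ^ 3 + 1))) :=
    ((hpol (18 * X 0 ^ 4) (fun p => 18 * p 0 ^ 4) fun p => by simp).fun_mul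
      (((hpol (X 0 ^ 3 + 4) (fun p => p 0 ^ 3 + 4) fun p => by simp).fun_pow 2).fun_mul
        (hpol (X 0 ^ 3 + 1) (fun p => p 0 ^ 3 + 1) fun p => by simp).fun_sqrt).fun_inv).congr
      fun p _ => by rw [div_eq_mul_inv]
  obtain ⟨S₁₈, hS₁₈d, hS₁₈i⟩ := exists_cubicPlusRep 18
  obtain ⟨W, hWd, hWi⟩ : ∃ W : IntegralRep 1, W.domain = pos ∧
      W.integrand = fun p => 18 * p 0 ^ 4 / ((p 0 ^ 3 + 4) ^ 2 * Real.sqrt (p 0 ^ 3 + 1)) := by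
    refine link43_exists_rep_of_abs_le S₁₈ hPos (fun p hp => ?_) hWsa fun p hp => ?_
    · rw [hS₁₈d]; show -1 < p 0; linarith [show 0 < p 0 from hp]
    · have hp0 : 0 < p 0 := hp
      have hs : 0 < Real.sqrt (p 0 ^ 3 + 1) := Real.sqrt_pos.2 (by positivity)
      have h4 : p 0 ^ 4 ≤ (p 0 ^ 3 + 4) ^ 2 := by
        rcases le_or_gt (p 0) 1 with h | h
        · nlinarith [pow_le_one₀ hp0.le h (n := 4), pow_nonneg hp0.le 3, pow_nonneg hp0.le 6]
        · nlinarith [pow_nonneg hp0.le 4, pow_nonneg hp0.le 3,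
            mul_le_mul_of_nonneg_left (one_le_pow₀ h.le (n := 2)) (pow_nonneg hp0.le 4)]
      simp only [hS₁₈i]
      push_cast
      rw [abs_of_nonneg (by positivity), ← div_div]
      exact div_le_div_of_nonneg_right ((div_le_iff₀ (by positivity)).2 (by nlinarith)) hs.le
  have hmemW : ∀ p ∈ W.domain, 0 < p 0 := fun p hp => by rw [hWd] at hp; exact hp
  have hWG : KZ.of W - KZ.of G ∈ KZ.relations := by
    refine KZ.changeOfVariablesRel_subset_relations (of_sub_of_mem_changeOfVariablesRel_dimOne W G
      (fun s => s ^ 3 / (s ^ 3 + 1)) (fun s => 3 * s ^ 2 / (s ^ 3 + 1) ^ 2) ?_ (fun p hp => hφd (hmemW p hp))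
      (fun p hp q hq h => hφinj (hmemW p hp) (hmemW q hq) h) ?_ fun p hp => ?_)
    · refine isSemialgebraicFunOn_ratFun₁ W.isSemialgebraic_domain (X 0 ^ 3) (X 0 ^ 3 + 1)
        (fun s : ℝ => s ^ 3 / (s ^ 3 + 1)) (fun p hp => ?_) fun p _ => ?_
      · have h0 := hmemW p hp
        simp only [map_add, map_pow, map_one, MvPolynomial.aeval_X]
        positivity
      · simp only [map_add, map_pow, map_one, MvPolynomial.aeval_X]
    · rw [hGd, hUd, hWd]
      exact (image_fin_one hφim).symm
    · have hp' := hmemW p hp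
      have hmem : (fun _ : Fin 1 => p 0 ^ 3 / (p 0 ^ 3 + 1)) ∈ U.domain := by rw [hUd]; exact hφmem hp'
      have e1 : U.integrand (fun _ : Fin 1 => p 0 ^ 3 / (p 0 ^ 3 + 1)) = (p 0 ^ 3 / (p 0 ^ 3 + 1)) ^ (-(1:ℝ) / 3) *
          (1 - p 0 ^ 3 / (p 0 ^ 3 + 1)) ^ (-(1:ℝ) / 6) := hUi hmem
      rw [hWi, hGi]
      simp only [hDi]
      rw [e1]
      exact (link45_jacobian hp' rfl).symm
  -- Step 3: rule (1a) at `x = 2`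
  have h2 : IsAlgebraic ℚ (2:ℝ) := by simpa using isAlgebraic_nat (R := ℚ) (A := ℝ) 2
  have hM : IsSemialgebraic ℚ {p : Fin 1 → ℝ | 0 < p 0 ∧ p 0 < 2} :=
    (KZ.isSemialgebraic_setOf_const_lt_apply isAlgebraic_zero 0).inter (KZ.isSemialgebraic_setOf_apply_lt_const h2 0)
  have hP : IsSemialgebraic ℚ {p : Fin 1 → ℝ | 2 < p 0} := KZ.isSemialgebraic_setOf_const_lt_apply h2 0
  have hMsub : {p : Fin 1 → ℝ | 0 < p 0 ∧ p 0 < 2} ⊆ W.domain := fun p hp => by rw [hWd]; exact hp.1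
  have hPsub : {p : Fin 1 → ℝ | 2 < p 0} ⊆ W.domain := fun p hp => by
    rw [hWd]; show 0 < p 0; linarith [show 2 < p 0 from hp]
  set W₁ := W.restrict _ hM hMsub with hW₁
  set W₂ := W.restrict _ hP hPsub with hW₂
  have hsplit : KZ.of W - KZ.of W₁ - KZ.of W₂ ∈ KZ.relations := by
    refine of_sub_of_sub_mem_relations_split W W₁ W₂ h2 ?_ ?_ (fun _ _ => rfl) (fun _ _ => rfl)
    · rw [hW₁, IntegralRep.domain_restrict, hWd]; ext p; simp only [mem_setOf_eq, mem_inter_iff, hpos_def]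
    · rw [hW₂, IntegralRep.domain_restrict, hWd]; ext p; simp only [mem_setOf_eq, mem_inter_iff, hpos_def]
      exact ⟨fun h => ⟨by linarith, h⟩, fun h => h.2⟩
  -- Step 4: `T = [(1,∞), 1/(X²√(X³−1))]`, the hypotheses on the two arcs, scaling and rule (1b)
  have hs3 : Real.sqrt 3 * Real.sqrt 3 = 3 := Real.mul_self_sqrt (by norm_num)
  have hkh := link45_isAlgebraic_rat_mul_sqrt3 (1 / 2)
  have hk₂ := link45_isAlgebraic_rat_mul_sqrt3 (2 / 3)
  have hk₄ := link45_isAlgebraic_rat_mul_sqrt3 (4 / 3)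
  have hTail : IsSemialgebraic ℚ {x : Fin 1 → ℝ | 1 < x 0} := KZ.isSemialgebraic_setOf_const_lt_apply isAlgebraic_one 0
  have hpol' : ∀ (q : MvPolynomial (Fin 1) ℚ) (f : (Fin 1 → ℝ) → ℝ), (∀ p, aeval p q = f p) →
      IsSemialgebraicFunOn ℚ {x : Fin 1 → ℝ | 1 < x 0} f := fun q f hf =>
    (isSemialgebraicFunOn_aeval hTail q).congr fun p _ => hf p
  have hTsa : IsSemialgebraicFunOn ℚ {x : Fin 1 → ℝ | 1 < x 0} (fun p => 1 / (p 0 ^ 2 * Real.sqrt (p 0 ^ 3 - 1))) :=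
    ((hpol' (X 0 ^ 2) (fun p => p 0 ^ 2) fun p => by simp).fun_mul
      (hpol' (X 0 ^ 3 - 1) (fun p => p 0 ^ 3 - 1) fun p => by simp).fun_sqrt).fun_inv.congr fun p _ => by rw [one_div]
  obtain ⟨T₁, hT₁d, hT₁i⟩ := exists_cubicMinusRep 1
  obtain ⟨T, hTd, hTi⟩ : ∃ T : IntegralRep 1, T.domain = {x : Fin 1 → ℝ | 1 < x 0} ∧
      T.integrand = fun p => 1 / (p 0 ^ 2 * Real.sqrt (p 0 ^ 3 - 1)) := by
    refine link43_exists_rep_of_abs_le T₁ hTail (fun p hp => by rw [hT₁d]; exact hp) hTsa fun p hp => ?_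
    have hp1 : 1 < p 0 := hp
    have hs : 0 < Real.sqrt (p 0 ^ 3 - 1) := Real.sqrt_pos.2 ((cube_sub_one_pos_iff _).2 hp1)
    simp only [hT₁i, Rat.cast_one]
    rw [abs_of_nonneg (by positivity), ← div_div]
    exact div_le_div_of_nonneg_right (div_le_one_of_le₀ (by nlinarith) (by positivity)) hs.le
  set S₁ := W₁.constMul _ hkh with hS₁
  set S₂ := W₂.constMul _ hkh with hS₂
  have hWint : ∀ x : Fin 1 → ℝ, (((1 / 2 : ℚ) : ℝ) * Real.sqrt 3) * W.integrand x =
      9 * Real.sqrt 3 * x 0 ^ 4 / ((x 0 ^ 3 + 4) ^ 2 * Real.sqrt (x 0 ^ 3 + 1)) := fun x => by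
    rw [hWi]; push_cast; ring
  have eS₁ : KZ.Equivalent S₁ T := hIso1 S₁ T rfl
    (fun x _ => by simp only [hS₁, IntegralRep.integrand_constMul, hW₁, IntegralRep.integrand_restrict, hWint])
    hTd (fun x _ => by rw [hTi])
  have eS₂ : KZ.Equivalent S₂ T := hIso2 S₂ T rfl
    (fun x _ => by simp only [hS₂, IntegralRep.integrand_constMul, hW₂, IntegralRep.integrand_restrict, hWint])
    hTd (fun x _ => by rw [hTi])
  have hscale : ∀ x : Fin 1 → ℝ, W.integrand x =
      (((2 / 3 : ℚ) : ℝ) * Real.sqrt 3) * ((((1 / 2 : ℚ) : ℝ) * Real.sqrt 3) * W.integrand x) := fun x => by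
    push_cast
    linear_combination (-(1:ℝ) / 3 * W.integrand x) * hs3
  have hW₁S : KZ.of W₁ - KZ.of (S₁.constMul _ hk₂) ∈ KZ.relations :=
    KZ.of_sub_of_mem_relations_of_eqOn rfl fun x _ => by
      simp only [hS₁, IntegralRep.integrand_constMul, hW₁, IntegralRep.integrand_restrict]; exact hscale x
  have hW₂S : KZ.of W₂ - KZ.of (S₂.constMul _ hk₂) ∈ KZ.relations :=
    KZ.of_sub_of_mem_relations_of_eqOn rfl fun x _ => by
      simp only [hS₂, IntegralRep.integrand_constMul, hW₂, IntegralRep.integrand_restrict]; exact hscale x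
  have h1b : KZ.of (T.constMul _ hk₄) - KZ.of (T.constMul _ hk₂) - KZ.of (T.constMul _ hk₂) ∈ KZ.integrandAddRel := by
    refine ⟨1, T.constMul _ hk₄, T.constMul _ hk₂, T.constMul _ hk₂, rfl, rfl, fun x _ => ?_, rfl⟩
    simp only [Pi.add_apply, IntegralRep.integrand_constMul]
    push_cast
    ring
  have hTA : KZ.of (T.constMul _ hk₄) - KZ.of A ∈ KZ.relations := by
    refine KZ.of_sub_of_mem_relations_of_eqOn (by rw [hAd, IntegralRep.domain_constMul, hTd]) fun x hx => ?_
    have hx' : 1 < x 0 := by rw [IntegralRep.domain_constMul, hTd] at hx; exact hx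
    rw [hAi (show x ∈ A.domain by rw [hAd]; exact hx')]
    simp only [IntegralRep.integrand_constMul, hTi]
    have hsq : 0 < Real.sqrt (x 0 ^ 3 - 1) := Real.sqrt_pos.2 ((cube_sub_one_pos_iff (x 0)).2 hx')
    have hx0 : 0 < x 0 := by linarith
    have hs0 : 0 < Real.sqrt 3 := Real.sqrt_pos.2 (by norm_num)
    push_cast
    field_simp
    linear_combination hs3
  -- compose
  show KZ.of U - KZ.of A ∈ KZ.relations
  have hsum : KZ.of U - KZ.of A = (KZ.of U - KZ.of G) - (KZ.of W - KZ.of G) + (KZ.of W - KZ.of W₁ - KZ.of W₂) +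
      (KZ.of W₁ - KZ.of (S₁.constMul _ hk₂)) + (KZ.of (S₁.constMul _ hk₂) - KZ.of (T.constMul _ hk₂)) +
      (KZ.of W₂ - KZ.of (S₂.constMul _ hk₂)) + (KZ.of (S₂.constMul _ hk₂) - KZ.of (T.constMul _ hk₂)) -
      (KZ.of (T.constMul _ hk₄) - KZ.of (T.constMul _ hk₂) - KZ.of (T.constMul _ hk₂)) +
      (KZ.of (T.constMul _ hk₄) - KZ.of A) := by
    abel
  rw [hsum]
  exact KZ.relations.add_mem (KZ.relations.sub_mem (KZ.relations.add_mem (KZ.relations.add_mem (KZ.relations.add_mem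
    (KZ.relations.add_mem (KZ.relations.add_mem (KZ.relations.sub_mem hUG hWG) hsplit) hW₁S) (eS₁.constMul _ hk₂)) hW₂S)
    (eS₂.constMul _ hk₂)) (KZ.integrandAddRel_subset_relations h1b)) hTA

end Summit.KontsevichZagierPeriods.FermatIsogeny.BetaLinearSector.Sixths

end
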